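import Literature.Topology.PlaneTopology.GermRegions
import Literature.Probability.LatticeModels.KilledWalkLaplacian
import HarnessLib

/-!
# Germ regions on the lattice: the vertex sets `Θ(s)` of the edge-killed walk and their exits

Topic `Literature/Probability/LatticeModels` (continuation of `Topology/PlaneTopology/GermRegions.lean`
and `KilledWalkLaplacian.lean`). For a Jordan domain `D`, a boundary point `b`, a scale `s`, a base
point `g` and a far point `o`, `GermRegions` constructs the germ region `U(s) = germRegion D b s g o`
(Chelkak–Wan's `Θ(r)`: the part of `D` on `b`'s side of the gate `S(s) ⊆ ∂(box b s)` facing `o`).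
Here we pass to the mesh `δℤ²`:

* `germSites D b s g o δ = Θ_δ(s)` — the sites of `Ω_δ = meshDomain D δ` whose mesh point lies in
  `U(s)`; finite; monotone in `s` (`germSites_mono`, from `germRegion_mono`);
* `germExits … = E_δ(s)` — the `killedOuterBoundary` of `Θ_δ(s)` for the edge-killed walk
  `discreteDomainGraph D δ`: sites outside `Θ_δ(s)` reached from it by a kept edge. The continuum
  lemma `exists_mem_gateArc_of_path` (a path in `D̄` from `U(s)` to `D ∖ U(s)` meets the gate arc;
  via `closure_gateSide_inter_closure_gateFar`) shows that the kept edge meets the gate arc, so exits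
  sit within mesh distance `δ` of the square (`sup_norm_germExit`), hence belong to `Θ_δ(s′)` for
  `s′ > s + 2δ` (`germExits_subset_germSites`);
* `germSites_subset_ball` / `ball_subset_germSites` — `Θ_δ(s) ⊆ B(b, R/2)` for `s ≤ s₀(R)` and
  `Ω_δ ∩ B(b, η) ⊆ Θ_δ(s)` (from `exists_germRegion_subset_closedBall`, `exists_ball_inter_subset_chamber`);
* the representation of a killed-harmonic function on `Θ_δ(s)` through its exits is
  `IsKilledHarmonicOn.eq_sum_killedPoisson` (KilledWalkLaplacian).

Everything is proved. [cite: ChelkakWan2021, §3.2]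
-/

noncomputable section

open Set Metric Filter
open scoped Topology

/-! ### Continuum: paths leaving the germ region meet the gate arc -/

namespace Literature.Topology.PlaneTopology

open Literature.Probability.RandomPlanarGeometry (JordanDomain)
open Literature.Probability.RandomPlanarGeometry.JordanDomain

/-- **The closures of the two sides of a gate meet only along the gate arc.** [folklore] -/
theorem closure_gateSide_inter_closure_gateFar {D Q : JordanDomain} (h2 : TwoOff D Q) {t₀ : ℝ}
    (ht₀ : t₀ ∈ gateParams D Q) {g : ℂ} (hg : g ∈ D.carrier \ gate D Q t₀) :
    closure (gateSide D Q g t₀) ∩ closure (gateFar D Q g t₀) ⊆ gateArc D Q t₀ := by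
  obtain ⟨hVo, hWo, -, -, σ, τ, hστ, hτσ, hends, hfV, hfW⟩ := gateSide_gateFar_spec h2 ht₀ hg
  have hdisj := disjoint_gateSide_gateFar (D := D) (Q := Q) g t₀
  intro z ⟨hzV, hzW⟩
  -- `z` is in both frontiers
  have hzV' : z ∈ frontier (gateSide D Q g t₀) := by
    rw [frontier_eq_closure_inter_closure]
    refine ⟨hzV, subset_closure fun hz => ?_⟩
    exact Set.disjoint_left.1 (hdisj.closure_right hVo) hz hzW
  have hzW' : z ∈ frontier (gateFar D Q g t₀) := by
    rw [frontier_eq_closure_inter_closure]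
    refine ⟨hzW, subset_closure fun hz => ?_⟩
    exact Set.disjoint_left.1 (hdisj.symm.closure_right hWo) hz hzV
  rw [hfV] at hzV'
  rw [hfW] at hzW'
  rcases hzV' with h | ⟨θ₁, hθ₁, rfl⟩
  · exact h
  rcases hzW' with h | ⟨θ₂, hθ₂, he⟩
  · exact h
  -- a common point of the two boundary arcs is a gate end
  obtain ⟨k, hk⟩ := D.exists_int_eq_add_of_boundary_eq he.symm
  have hk01 : k = 0 ∨ k = 1 := by
    have h1 : (0 : ℝ) ≤ k := by linarith [hθ₁.2, hθ₂.1]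
    have h2' : (k : ℝ) ≤ 1 := by linarith [hθ₁.1, hθ₂.2]
    have h3 : 0 ≤ k := by exact_mod_cast h1
    have h4 : k ≤ 1 := by exact_mod_cast h2'
    omega
  have hend : D.boundary θ₁ ∈ ({D.boundary σ, D.boundary τ} : Set ℂ) := by
    rcases hk01 with rfl | rfl
    · simp only [Int.cast_zero, add_zero] at hk
      have : θ₁ = τ := le_antisymm hθ₁.2 (hk ▸ hθ₂.1)
      rw [this]; exact Or.inr rfl
    · simp only [Int.cast_one] at hk
      have : θ₁ = σ := le_antisymm (by linarith [hθ₂.2]) hθ₁.1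
      rw [this]; exact Or.inl rfl
  rw [hends] at hend
  rcases hend with h | h
  · rw [h]; exact ⟨_, left_mem_Icc.2 ((gateLo_lt h2 ht₀).le.trans (lt_gateHi h2 ht₀).le), rfl⟩
  · rw [h]; exact ⟨_, right_mem_Icc.2 ((gateLo_lt h2 ht₀).le.trans (lt_gateHi h2 ht₀).le), rfl⟩

/-- The gate arc is closed. [folklore] -/
theorem isClosed_gateArc {D Q : JordanDomain} (t₀ : ℝ) : IsClosed (gateArc D Q t₀) :=
  (isCompact_Icc.image Q.continuous_boundary).isClosed

/-- **A path in `D̄` from the side of `g` to a point of `D` off that side meets the gate arc.**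
[folklore] -/
theorem exists_mem_gateArc_of_path {D Q : JordanDomain} (h2 : TwoOff D Q) {t₀ : ℝ}
    (ht₀ : t₀ ∈ gateParams D Q) {g : ℂ} (hg : g ∈ D.carrier \ gate D Q t₀)
    {γ : ℝ → ℂ} (hγ : ContinuousOn γ (Icc 0 1)) (hγD : ∀ t ∈ Icc (0 : ℝ) 1, γ t ∈ closure D.carrier)
    (h0 : γ 0 ∈ gateSide D Q g t₀) (h1 : γ 1 ∈ D.carrier) (h1' : γ 1 ∉ gateSide D Q g t₀) :
    ∃ t ∈ Icc (0 : ℝ) 1, γ t ∈ gateArc D Q t₀ := by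
  set V := gateSide D Q g t₀
  set W := gateFar D Q g t₀
  obtain ⟨hVo, hWo, -, -, -⟩ := gateSide_gateFar_spec h2 ht₀ hg
  -- `closure D ⊆ closure V ∪ closure W ∪ gateArc`
  have hDsub : closure D.carrier ⊆ closure V ∪ closure W ∪ gateArc D Q t₀ := by
    have h1 : D.carrier ⊆ V ∪ W ∪ gateArc D Q t₀ := fun z hz => by
      by_cases hzg : z ∈ gate D Q t₀
      · exact Or.inr (gate_subset_gateArc t₀ hzg)
      · have : z ∈ V ∪ W := by rw [gateSide_union_gateFar]; exact ⟨hz, hzg⟩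
        exact Or.inl this
    calc closure D.carrier ⊆ closure (V ∪ W ∪ gateArc D Q t₀) := closure_mono h1
      _ = closure V ∪ closure W ∪ gateArc D Q t₀ := by
        rw [closure_union, closure_union, (isClosed_gateArc t₀).closure_eq]
  -- the set of bad parameters
  set B : Set ℝ := {t | t ∈ Icc (0 : ℝ) 1 ∧ γ t ∉ closure V} with hB
  by_cases hBe : B = ∅
  · -- the whole path stays in `closure V`; its end is in `D ∩ frontier V = gate`
    have h1c : γ 1 ∈ closure V := by
      by_contra h; exact (eq_empty_iff_forall_notMem.1 hBe 1) ⟨right_mem_Icc.2 zero_le_one, h⟩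
    have hfr : γ 1 ∈ frontier V := ⟨h1c, by rw [hVo.interior_eq]; exact h1'⟩
    obtain ⟨-, -, -, -, σ, τ, -, -, -, hfV, -⟩ := gateSide_gateFar_spec h2 ht₀ hg
    rw [hfV] at hfr
    rcases hfr with h | ⟨θ, -, hθ⟩
    · exact ⟨1, right_mem_Icc.2 zero_le_one, h⟩
    · exfalso
      have hmem : D.boundary θ ∈ D.carrier ∩ frontier D.carrier := ⟨hθ ▸ h1, D.boundary_mem_frontier θ⟩
      rw [D.isOpen.inter_frontier_eq] at hmem; exact hmem
  · have hBne : B.Nonempty := nonempty_iff_ne_empty.2 hBe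
    have hBbdd : BddBelow B := ⟨0, fun t ht => ht.1.1⟩
    set t₂ := sInf B with ht₂
    have ht₂mem : t₂ ∈ Icc (0 : ℝ) 1 := by
      obtain ⟨t, ht⟩ := id hBne
      exact ⟨le_csInf hBne fun u hu => hu.1.1, (csInf_le hBbdd ht).trans ht.1.2⟩
    refine ⟨t₂, ht₂mem, ?_⟩
    -- `γ t₂ ∈ closure V`: otherwise, by continuity, smaller parameters are bad too
    have hcl : γ t₂ ∈ closure V := by
      by_contra hnot
      have ht₂B : t₂ ∈ B := ⟨ht₂mem, hnot⟩
      -- `t₂ > 0` since `γ 0 ∈ V`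
      have ht₂pos : 0 < t₂ := by
        rcases eq_or_lt_of_le ht₂mem.1 with h | h
        · exfalso; apply hnot; rw [← h]; exact subset_closure h0
        · exact h
      -- an open interval of bad parameters below `t₂`
      have hopen : IsOpen ((closure V)ᶜ) := isClosed_closure.isOpen_compl
      have hcont : ContinuousWithinAt γ (Icc 0 1) t₂ := hγ t₂ ht₂mem
      have hev : ∀ᶠ t in 𝓝[Icc 0 1] t₂, γ t ∈ (closure V)ᶜ := hcont (hopen.mem_nhds hnot)
      rw [eventually_nhdsWithin_iff, Metric.eventually_nhds_iff] at hev
      obtain ⟨ε, hε, hεB⟩ := hev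
      set t := t₂ - min (ε / 2) (t₂ / 2) with htdef
      have hmin : 0 < min (ε / 2) (t₂ / 2) := lt_min (by positivity) (by positivity)
      have htI : t ∈ Icc (0 : ℝ) 1 := ⟨by rw [htdef]; linarith [min_le_right (ε / 2) (t₂ / 2)],
        by rw [htdef]; linarith [ht₂mem.2]⟩
      have htd : dist t t₂ < ε := by
        rw [Real.dist_eq, htdef, show t₂ - min (ε / 2) (t₂ / 2) - t₂ = -min (ε / 2) (t₂ / 2) by ring, abs_neg,
          abs_of_pos hmin]
        linarith [min_le_left (ε / 2) (t₂ / 2)]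
      have htB : t ∈ B := ⟨htI, hεB htd htI⟩
      have := csInf_le hBbdd htB
      rw [← ht₂] at this
      linarith
    -- `γ t₂` is a limit of bad points, which lie in `closure W ∪ gateArc`
    have hcl' : γ t₂ ∈ closure (closure W ∪ gateArc D Q t₀) := by
      have hmem : t₂ ∈ closure B := csInf_mem_closure hBne hBbdd
      have hmap : MapsTo γ B (closure W ∪ gateArc D Q t₀) := fun t ht => by
        have := hDsub (hγD t ht.1)
        rcases this with (h | h) | h
        · exact absurd h ht.2
        · exact Or.inl h
        · exact Or.inr h
      have hcw : ContinuousWithinAt γ B t₂ := (hγ t₂ ht₂mem).mono fun t ht => ht.1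
      exact closure_mono hmap.image_subset (hcw.mem_closure_image hmem)
    rw [(isClosed_closure.union (isClosed_gateArc t₀)).closure_eq] at hcl'
    rcases hcl' with h | h
    · exact closure_gateSide_inter_closure_gateFar h2 ht₀ hg ⟨hcl, h⟩
    · exact h

end Literature.Topology.PlaneTopology

/-! ### Lattice: the vertex sets `Θ_δ(s)` and their exits -/

namespace Literature.Probability.LatticeModels

open Literature.Topology.PlaneTopology
open Literature.Topology.PlaneTopology renaming box → pbox, mem_box → mem_pbox, box_mono → pbox_mono
open Literature.Probability.RandomPlanarGeometry (JordanDomain)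

-- `pbox b s` is the open sup-norm box `Literature.Topology.PlaneTopology.pbox b s` (the name `box` is taken in
-- this namespace by the lattice boxes `LatticeModels.box d m`).

variable (D : JordanDomain) (b : ℂ) {s : ℝ} (hs : 0 < s) (g o : ℂ) (δ : ℝ)

/-- **`Θ_δ(s)`**: the sites of `Ω_δ` whose mesh point lies in the germ region `U(s)`. [cite: ChelkakWan2021, §3.2] -/
def germSites : Set (Site 2) := {z | z ∈ meshDomain D.carrier δ ∧ meshPoint δ z ∈ germRegion D b hs g o}

/-- **`E_δ(s)`**: the exits of `Θ_δ(s)` for the edge-killed walk — sites outside `Θ_δ(s)` joined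
to it by an edge of `Ω_δ`. [cite: ChelkakWan2021, §3.2] -/
def germExits : Set (Site 2) := killedOuterBoundary (discreteDomainGraph D.carrier δ) (germSites D b hs g o δ)

variable {D b hs g o δ}

/-- `Θ_δ(s) ⊆ Ω_δ`. [folklore] -/
theorem germSites_subset_meshDomain : germSites D b hs g o δ ⊆ meshDomain D.carrier δ := fun _ hz => hz.1

/-- `Θ_δ(s)` is finite. [folklore] -/
theorem germSites_finite (hδ : 0 < δ) : (germSites D b hs g o δ).Finite :=
  (meshDomain_finite D.isBounded hδ).subset germSites_subset_meshDomain

/-- **Nesting**: `Θ_δ(s) ⊆ Θ_δ(s′)` for `s < s′`. [cite: ChelkakWan2021, §3.2] -/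
theorem germSites_mono {s' : ℝ} (hss' : s < s') (h2 : TwoOff D (boxJD b hs)) (h2' : TwoOff D (boxJD b (hs.trans hss')))
    (hg : g ∈ D.carrier ∩ pbox b s) (ho : o ∈ D.carrier) (hoc : o ∉ closedBox b s') :
    germSites D b hs g o δ ⊆ germSites D b (hs.trans hss') g o δ := fun _ hz =>
  ⟨hz.1, germRegion_mono hs hss' h2 h2' hg ho hoc hz.2⟩

/-- Exits are sites of `Ω_δ` off `Θ_δ(s)`, adjacent to it. [folklore] -/
theorem mem_germExits_iff {x : Site 2} : x ∈ germExits D b hs g o δ ↔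
    x ∉ germSites D b hs g o δ ∧ ∃ v ∈ germSites D b hs g o δ, ∃ e : SRW.Dir 2,
      x = v + SRW.stepVec e ∧ (discreteDomainGraph D.carrier δ).Adj v x := Iff.rfl

/-- Exits lie in `Ω_δ`. [folklore] -/
theorem germExits_subset_meshDomain : germExits D b hs g o δ ⊆ meshDomain D.carrier δ := by
  rintro x ⟨-, v, -, e, -, hadj⟩
  exact (discreteDomainGraph_adj_iff.1 hadj).2.2

/-- Coordinates of a point of the segment between lattice neighbours stay within `δ` of those of
the first end. [folklore] -/
theorem abs_re_sub_le_of_mem_segment {δ : ℝ} (hδ : 0 ≤ δ) {v : Site 2} (e : SRW.Dir 2) {p : ℂ}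
    (hp : p ∈ segment ℝ (meshPoint δ v) (meshPoint δ (v + SRW.stepVec e))) :
    |p.re - (meshPoint δ v).re| ≤ δ ∧ |p.im - (meshPoint δ v).im| ≤ δ := by
  obtain ⟨a, c, ha, hc, hac, rfl⟩ := hp
  have hre : (meshPoint δ (v + SRW.stepVec e)).re - (meshPoint δ v).re = δ * SRW.stepVec e 0 := by
    simp only [meshPoint_re, Pi.add_apply, Int.cast_add]; ring
  have him : (meshPoint δ (v + SRW.stepVec e)).im - (meshPoint δ v).im = δ * SRW.stepVec e 1 := by
    simp only [meshPoint_im, Pi.add_apply, Int.cast_add]; ring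
  have h0 : |(SRW.stepVec e 0 : ℝ)| ≤ 1 := by exact_mod_cast SRW.abs_stepVec_apply_le e 0
  have h1 : |(SRW.stepVec e 1 : ℝ)| ≤ 1 := by exact_mod_cast SRW.abs_stepVec_apply_le e 1
  have ha' : a = 1 - c := by linarith
  have hc1 : c ≤ 1 := by linarith
  constructor
  · have : (a • meshPoint δ v + c • meshPoint δ (v + SRW.stepVec e)).re - (meshPoint δ v).re =
        c * (δ * SRW.stepVec e 0) := by
      rw [← hre, ha']; simp only [Complex.add_re, Complex.smul_re, smul_eq_mul]; ring
    rw [this, abs_mul, abs_of_nonneg hc, abs_mul, abs_of_nonneg hδ]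
    calc c * (δ * |(SRW.stepVec e 0 : ℝ)|) ≤ 1 * δ :=
          mul_le_mul hc1 (mul_le_of_le_one_right hδ h0) (by positivity) zero_le_one
      _ = δ := one_mul δ
  · have : (a • meshPoint δ v + c • meshPoint δ (v + SRW.stepVec e)).im - (meshPoint δ v).im =
        c * (δ * SRW.stepVec e 1) := by
      rw [← him, ha']; simp only [Complex.add_im, Complex.smul_im, smul_eq_mul]; ring
    rw [this, abs_mul, abs_of_nonneg hc, abs_mul, abs_of_nonneg hδ]
    calc c * (δ * |(SRW.stepVec e 1 : ℝ)|) ≤ 1 * δ :=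
          mul_le_mul hc1 (mul_le_of_le_one_right hδ h1) (by positivity) zero_le_one
      _ = δ := one_mul δ

section Exits

variable (h2 : TwoOff D (boxJD b hs)) (hg : g ∈ D.carrier ∩ pbox b s) (ho : o ∈ D.carrier)
  (hoc : o ∉ closedBox b s) (hδ : 0 < δ)
include h2 hg ho hoc hδ

/-- **The kept edge into an exit meets the gate arc**, so an exit's mesh point is within mesh
distance `δ` of the square: its sup-distance from `b` is in `[s - δ, s + δ]`. [cite: ChelkakWan2021, §3.2] -/
theorem sup_norm_germExit {x : Site 2} (hx : x ∈ germExits D b hs g o δ) :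
    meshPoint δ x ∈ closedBox b (s + δ) ∧ meshPoint δ x ∉ pbox b (s - δ) := by
  obtain ⟨hxS, v, hv, e, rfl, hadj⟩ := hx
  set Q := boxJD b hs
  set t₀ := germGateParam D b hs g o
  have hgq : g ∈ D.carrier \ gate D Q t₀ := base_not_mem_gate hs hg t₀
  -- hypotheses of the path lemma for the segment
  have hseg : segment ℝ (meshPoint δ v) (meshPoint δ (v + SRW.stepVec e)) ⊆ closure D.carrier :=
    (meshGraph_adj_iff.1 (discreteDomainGraph_adj_iff.1 hadj).1).2
  have hxD : meshPoint δ (v + SRW.stepVec e) ∈ D.carrier :=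
    meshDomain_subset_meshVertices _ _ (discreteDomainGraph_adj_iff.1 hadj).2.2
  have hxU : meshPoint δ (v + SRW.stepVec e) ∉ germRegion D b hs g o := fun h =>
    hxS ⟨(discreteDomainGraph_adj_iff.1 hadj).2.2, h⟩
  have ht₀ : t₀ ∈ gateParams D Q := (germGateParam_spec h2 hg ho hoc).1
  set γ : ℝ → ℂ := fun t => AffineMap.lineMap (meshPoint δ v) (meshPoint δ (v + SRW.stepVec e)) t with hγ
  have hγc : ContinuousOn γ (Icc 0 1) := AffineMap.lineMap_continuous.continuousOn
  have hγseg : ∀ t ∈ Icc (0 : ℝ) 1, γ t ∈ segment ℝ (meshPoint δ v) (meshPoint δ (v + SRW.stepVec e)) :=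
    fun t ht => by rw [segment_eq_image_lineMap]; exact ⟨t, ht, rfl⟩
  obtain ⟨t, ht, hp⟩ := exists_mem_gateArc_of_path h2 ht₀ hgq hγc (fun t ht => hseg (hγseg t ht))
    (by simp only [hγ, AffineMap.lineMap_apply_zero]; exact hv.2)
    (by simp only [hγ, AffineMap.lineMap_apply_one]; exact hxD)
    (by simp only [hγ, AffineMap.lineMap_apply_one]; exact hxU)
  -- `γ t` is on the square and within `δ` of both ends in each coordinate
  have hsq : γ t ∈ closedBox b s ∧ γ t ∉ pbox b s := by
    obtain ⟨θ, -, hθ⟩ := hp; rw [← hθ]; exact boundary_boxJD_mem b hs θ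
  have hnear := abs_re_sub_le_of_mem_segment hδ.le e (hγseg t ht)
  -- coordinates of the exit relative to `γ t`
  have hre : (meshPoint δ (v + SRW.stepVec e)).re - (meshPoint δ v).re = δ * SRW.stepVec e 0 := by
    simp only [meshPoint_re, Pi.add_apply, Int.cast_add]; ring
  have him : (meshPoint δ (v + SRW.stepVec e)).im - (meshPoint δ v).im = δ * SRW.stepVec e 1 := by
    simp only [meshPoint_im, Pi.add_apply, Int.cast_add]; ring
  have h0 : |(SRW.stepVec e 0 : ℝ)| ≤ 1 := by exact_mod_cast SRW.abs_stepVec_apply_le e 0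
  have h1 : |(SRW.stepVec e 1 : ℝ)| ≤ 1 := by exact_mod_cast SRW.abs_stepVec_apply_le e 1
  have hdre : |(meshPoint δ (v + SRW.stepVec e)).re - (γ t).re| ≤ δ := by
    obtain ⟨a, c, ha, hc, hac, hγt⟩ := hγseg t ht
    rw [← hγt]
    have hc' : c = 1 - a := by linarith
    have : (meshPoint δ (v + SRW.stepVec e)).re - (a • meshPoint δ v + c • meshPoint δ (v + SRW.stepVec e)).re =
        a * (δ * SRW.stepVec e 0) := by
      rw [← hre, hc']; simp only [Complex.add_re, Complex.smul_re, smul_eq_mul]; ring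
    rw [this, abs_mul, abs_of_nonneg ha, abs_mul, abs_of_nonneg hδ.le]
    calc a * (δ * |(SRW.stepVec e 0 : ℝ)|) ≤ 1 * δ :=
          mul_le_mul (by linarith) (mul_le_of_le_one_right hδ.le h0) (by positivity) zero_le_one
      _ = δ := one_mul δ
  have hdim : |(meshPoint δ (v + SRW.stepVec e)).im - (γ t).im| ≤ δ := by
    obtain ⟨a, c, ha, hc, hac, hγt⟩ := hγseg t ht
    rw [← hγt]
    have hc' : c = 1 - a := by linarith
    have : (meshPoint δ (v + SRW.stepVec e)).im - (a • meshPoint δ v + c • meshPoint δ (v + SRW.stepVec e)).im =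
        a * (δ * SRW.stepVec e 1) := by
      rw [← him, hc']; simp only [Complex.add_im, Complex.smul_im, smul_eq_mul]; ring
    rw [this, abs_mul, abs_of_nonneg ha, abs_mul, abs_of_nonneg hδ.le]
    calc a * (δ * |(SRW.stepVec e 1 : ℝ)|) ≤ 1 * δ :=
          mul_le_mul (by linarith) (mul_le_of_le_one_right hδ.le h1) (by positivity) zero_le_one
      _ = δ := one_mul δ
  rw [abs_le] at hdre hdim
  obtain ⟨hq1, hq2⟩ := hsq
  rw [mem_closedBox] at hq1 ⊢
  rw [mem_pbox] at hq2 ⊢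
  refine ⟨⟨by linarith [hq1.1], by linarith [hq1.2.1], by linarith [hq1.2.2.1], by linarith [hq1.2.2.2]⟩, ?_⟩
  rintro ⟨k1, k2, k3, k4⟩
  exact hq2 ⟨by linarith, by linarith, by linarith, by linarith⟩

/-- **Exits of `Θ_δ(s)` are sites of `Θ_δ(s′)` once `s′ > s + 2δ`.** [cite: ChelkakWan2021, §3.2] -/
theorem germExits_subset_germSites {s' : ℝ} (hss' : s + 2 * δ < s') (h2' : TwoOff D (boxJD b (hs.trans (by linarith))))
    (hoc' : o ∉ closedBox b s') :
    germExits D b hs g o δ ⊆ germSites D b (hs.trans (by linarith : s < s')) g o δ := by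
  have hss : s < s' := by linarith
  intro x hx
  by_contra hxS'
  have hxm : x ∈ meshDomain D.carrier δ := germExits_subset_meshDomain hx
  -- `x` is then an exit at scale `s'` as well (adjacent to a site of `Θ(s) ⊆ Θ(s')`)
  have hx' : x ∈ germExits D b (hs.trans hss) g o δ := by
    obtain ⟨-, v, hv, e, hxe, hadj⟩ := hx
    exact ⟨hxS', v, germSites_mono hss h2 h2' hg ho hoc' hv, e, hxe, hadj⟩
  have h1 := (sup_norm_germExit h2 hg ho hoc hδ hx).1
  have h2x := (sup_norm_germExit h2' ⟨hg.1, pbox_mono hss.le hg.2⟩ ho hoc' hδ hx').2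
  exact h2x (closedBox_subset_box (by linarith) h1)

end Exits

/-! ### Metric containment and the germ on the lattice -/

/-- **`Θ_δ(s)` lies in the ball of radius `R/2` about `b`** under the hypotheses of
`exists_germRegion_subset_closedBall`. [cite: ChelkakWan2021, §3.2] -/
theorem germSites_subset_ball {R : ℝ} (hsub : germRegion D b hs g o ⊆ closedBall b (R / 2)) {z : Site 2}
    (hz : z ∈ germSites D b hs g o δ) : dist (meshPoint δ z) b ≤ R / 2 :=
  mem_closedBall.1 (hsub hz.2)

/-- **Sites of `Ω_δ` near `b` belong to `Θ_δ(s)`** (ULC germ): if `D ∩ ball b η ⊆ chamber` then every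
site of `Ω_δ` with mesh point within `η` of `b` is in `Θ_δ(s)`. [cite: ChelkakWan2021, §3.2] -/
theorem mem_germSites_of_dist_lt {η : ℝ} (hg : g ∈ D.carrier ∩ pbox b s)
    (hsub : D.carrier ∩ ball b η ⊆ chamber D b s g) {z : Site 2} (hz : z ∈ meshDomain D.carrier δ)
    (hzb : dist (meshPoint δ z) b < η) : z ∈ germSites D b hs g o δ :=
  ⟨hz, chamber_subset_germRegion hg (hsub ⟨meshDomain_subset_meshVertices _ _ hz, mem_ball.2 hzb⟩)⟩

/-- Sites of `Θ_δ(s)` have mesh points in `D` at sup-distance `< s'` from `b` whenever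
`U(s) ⊆ pbox b s'` … more usefully: they lie in `D`. [folklore] -/
theorem meshPoint_mem_of_mem_germSites {z : Site 2} (hz : z ∈ germSites D b hs g o δ) :
    meshPoint δ z ∈ D.carrier := meshDomain_subset_meshVertices _ _ hz.1

end Literature.Probability.LatticeModels
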